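import Summits.BirchSwinnertonDyer.BirchSwinnertonDyer.Theorems.AdditiveBranchIMCGordTwoRankZeroOffCaseOneFieldSupplyR0Partner
import Summits.BirchSwinnertonDyer.BirchSwinnertonDyer.Theorems.AdditiveBranchIMCGordTwoRankZeroOffCaseOneFieldSupplyR0Arith
import Literature.NumberTheory.EllipticCurves.NonvanishingTwistsAdmissibleFieldOfFriedbergHoffsteinProofs
import Literature.NumberTheory.EllipticCurves.HeegnerFieldOfDiscriminantProofs
import Literature.NumberTheory.QuadraticFields.FundamentalDiscriminant
import HarnessLib

/-!
# Route `AdditiveBranchIMC` (rung K1), cruxes 19357 / 19359, supply stubs: FIELD 2, part 2a —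
# the AUXILIARY TWIST of root number `−1` (for the `p`-ramified Kolyvagin class)
# (Friedberg–Hoffstein Thm. B in the Jetchev–Skinner–Wan form, applied to an auxiliary twist of root number `−1`)

Cell `bsd-addord`, seat `bsd-line-addord-w2`. THEOREMS ONLY; the printed inputs are explicit hypotheses:
`friedbergHoffstein_exists_heegnerField_splitDivisors_twist_ne_zero` (FH Thm. B with prescribed
splitting — NOT in the lines' `PrintedFactsR0`/`PrintedFactsM`, which is why the supply stubs are
mis-stated as registered), modularity (`exists_isNewformOf`, `hasEntireLFunction_rat`).

THE CONSTRUCTION (`exists_ramifiedClass_partner`). `(E, p)` on the (G-ord, `e = 2`) cell, `p ≥ 5`,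
`w(E) = +1`, Wan prime `q`; tame-road field `K` (`q ∣ d_K`, other bad primes split, `2` split, `p` split);
`Wd` any model of `E^{(d_K)}`. Let `V ≅ E^{(p*)}` be the good-ordinary partner, `δ₁ = d_K/q*`, and `ℓ₀` a
Dirichlet prime (`exists_prime_star_prescribed`) with `(ℓ₀*/ℓ) = (p*q*/ℓ)` at the odd primes
`ℓ ∉ {p, q}` of `N_E N_{Wd}`, `(ℓ₀*/q) = (p*δ₁/q)`, `p*q*ℓ₀* ≡ 1 (mod 8)`, `(−1)^{(ℓ₀−1)/2} = −sign(p*δ₁)`,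
`ℓ₀ > N_E N_{Wd} |d_K|`. With `T = δ₁ℓ₀*`, the globally minimal `X ≅ V^{(T)}` has `w(X) = −1`
(`jacobiSym_rootNumber_sign`); FH gives a square-free `d < 0`, `d ≡ 1 (mod 8)`, `(d/ℓ) = 1` at every odd
prime of `2pqℓ₀ N_E N_{Wd} d_K` and of `N_X`, with `L(X^{(d)}, 1) ≠ 0`. Then `A :=` a globally minimal
model of `X^{(d)}`, `d'' := p*q*ℓ₀*d` (fundamental, `< 0`), `K'' := ℚ(√d'')`, and
`A ≅ Wd^{(d'')} ≅ E^{(u)}`, `u = p*Td`; `A` has analytic rank `0`, is good ordinary at `p`, every prime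
`ℓ ∉ {p, q}` of `N_E N_{Wd}` splits in `K''`, the common primes of `d''` and `N_E N_{Wd}` are `p, q`, the
free prime is `ℓ₀`, and `u` is a square at `q` and at every bad prime `≠ p` of `E` (Jacobi `= 1`,
`≡ 1 (mod 8)`), recorded for the local analysis of part 3.

References: [FriedbergHoffstein1995] Thm. B; [JetchevSkinnerWan2017] §7.4.1; [SilvermanAEC2009] X.5.4;
Murty–Murty 1997 Ch. 6 §1.
-/

set_option linter.dupNamespace false

noncomputable section

open scoped Classical

open WeierstrassCurve NumberField IsDedekindDomain
  Literature.NumberTheory.EllipticCurves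
  Literature.NumberTheory.EllipticCurves.ModularForms
  Literature.NumberTheory.EllipticCurves.Rank1Residual
  Literature.NumberTheory.QuadraticFields
  Summit.BirchSwinnertonDyer.Rank1Residual
  Summit.BirchSwinnertonDyer.Rank1Residual.Additive

namespace Summit.BirchSwinnertonDyer.BirchSwinnertonDyer.Theorems.ThreeFieldRoadSupply

open NumberTheorySymbols
open Summit.BirchSwinnertonDyer.BirchSwinnertonDyer.Theorems.AdditiveKoly.RamifiedHabitat (pStar_emod_four eq_of_prime_dvd_pStar)

section Class

variable (W : WeierstrassCurve ℚ) [W.IsElliptic] [W.IsGloballyMinimal] (p : ℕ) [hp : Fact p.Prime]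
  {q : ℕ} [hq : Fact q.Prime] (K : Type) [Field K] [NumberField K]

/-- `J(a | ℓ) = 1` excludes `ℓ ∣ a` (`ℓ` prime). [folklore] -/
theorem not_dvd_of_jacobiSym_eq_one {a : ℤ} {ℓ : ℕ} (hℓ : ℓ.Prime) (h : J(a | ℓ) = 1) :
    ¬ (ℓ : ℤ) ∣ a := by
  intro hdvd
  haveI : NeZero ℓ := ⟨hℓ.ne_zero⟩
  rw [jacobiSym.mod_left, Int.emod_eq_zero_of_dvd hdvd, jacobiSym.zero_left hℓ.one_lt] at h
  exact zero_ne_one h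

omit hq in
/-- `J(a | ℓ)² = 1` for a prime `ℓ ∤ a`. [folklore] -/
theorem jacobiSym_mul_self_eq_one {a : ℤ} {ℓ : ℕ} (hℓ : ℓ.Prime) (h : ¬ (ℓ : ℤ) ∣ a) :
    J(a | ℓ) * J(a | ℓ) = 1 := by
  have hg : a.gcd ℓ = 1 := by
    have h1 : (a.gcd ℓ : ℕ) ∣ ℓ := by exact_mod_cast Int.gcd_dvd_right a ℓ
    rcases (Nat.dvd_prime hℓ).mp h1 with h1 | h1
    · exact h1
    · exfalso
      apply h
      have h2 := Int.gcd_dvd_left a ℓ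
      rwa [h1] at h2
  rw [← sq, jacobiSym.sq_one hg]

omit hq in
/-- A prime `ℓ ∉ {p, q}` does not divide `p* q*`. [folklore] -/
theorem not_dvd_pStar_mul_pStar {ℓ : ℕ} (hℓ : ℓ.Prime) (hqP : q.Prime) (hℓp : ℓ ≠ p) (hℓq : ℓ ≠ q) :
    ¬ (ℓ : ℤ) ∣ ((-1 : ℤ) ^ (p / 2) * p) * ((-1 : ℤ) ^ (q / 2) * q) := by
  intro hd
  rcases Int.Prime.dvd_mul' hℓ hd with hd | hd
  · exact hℓp (eq_of_prime_dvd_pStar (p := p) hℓ hd)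
  · exact hℓq ((haveI := Fact.mk hqP; eq_of_prime_dvd_pStar (p := q) hℓ hd))

/-- **FIELD 2, step 1 — the auxiliary twist of root number `−1`.** For `(E, p)` on the (G-ord, `e = 2`)
cell with `p ≥ 5`, `w(E) = +1`, an odd prime `q ≠ p`, and the tame-road field `K` (`2` split, `q ∣ d_K`,
every bad prime `≠ q` split): the good-ordinary partner `V` (`E ≅ V^{(p*)}`, `N_E = N_V p²`), the genus
factor `δ₁` (`d_K = q* δ₁`), a Dirichlet prime `ℓ₀` outside `N_E N_{Wd} d_K` with the prescribed symbols
(`(ℓ₀*/ℓ) = (p*q*/ℓ)` at the odd primes `ℓ ∉ {p,q}` of `N_E N_{Wd}`, `p*q*ℓ₀* ≡ 1 (mod 8)`), and a globally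
minimal `X ≅ V^{(T)}`, `T = δ₁ℓ₀*`, with `T ≡ 1 (mod 4)`, `p*T < 0`, `(p*T/ℓ) = 1` at the odd primes of `N_V`,
`p*T ≡ 1 (mod 8)` if `2 ∣ N_V`, and `w(X) = −1` (`jacobiSym_rootNumber_sign`).
[cite: SilvermanAEC2009, X.5 Cor. 5.4 and App. C §16] [cite: IrelandRosen1990, Ch. 16 §1] -/
theorem exists_auxTwist
    (hmod : exists_isNewformOf) (hp5 : 5 ≤ p) (hw : W.rootNumber = 1) (hcell : N10.CellGordTwo W p)
    (hqp : q ≠ p) (hq2 : q ≠ 2)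
    (hK : IsImaginaryQuadratic K) (h2K : ((Ideal.span {(2 : ℤ)}).primesOver (𝓞 K)).ncard = 2)
    (hqd : (q : ℤ) ∣ NumberField.discr K)
    (hsplit : ∀ ℓ : ℕ, ℓ.Prime → ℓ ∣ W.conductorNorm ℤ → ℓ ≠ q →
      ((Ideal.span {(ℓ : ℤ)}).primesOver (𝓞 K)).ncard = 2) (M₀ : ℕ) (hM₀ : M₀ ≠ 0) :
    ∃ (V : WeierstrassCurve ℚ) (_ : V.IsElliptic) (_ : V.IsGloballyMinimal) (C' : VariableChange ℚ)
      (δ : ℤ) (ℓ₀ : ℕ) (X : WeierstrassCurve ℚ) (_ : X.IsElliptic) (_ : X.IsGloballyMinimal)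
      (CX : VariableChange ℚ),
      C' • V.quadraticTwist ((-1 : ℚ) ^ (p / 2) * p) = W ∧ GoodOrd V p ∧
      W.conductorNorm ℤ = V.conductorNorm ℤ * p ^ 2 ∧
      NumberField.discr K = ((-1 : ℤ) ^ (q / 2) * q) * δ ∧ Squarefree δ ∧ ¬ (p : ℤ) ∣ δ ∧ δ ≠ 0 ∧
      ℓ₀.Prime ∧ ℓ₀ ≠ p ∧ ℓ₀ ≠ q ∧ ¬ ℓ₀ ∣ W.conductorNorm ℤ * M₀ ∧ ¬ (ℓ₀ : ℤ) ∣ δ ∧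
      (((-1 : ℤ) ^ (p / 2) * p) * ((-1 : ℤ) ^ (q / 2) * q) * ((-1 : ℤ) ^ (ℓ₀ / 2) * ℓ₀)) % 8 = 1 ∧
      (∀ ℓ : ℕ, ℓ.Prime → ℓ ∣ W.conductorNorm ℤ * M₀ → ℓ ≠ 2 → ℓ ≠ p → ℓ ≠ q →
        J((-1 : ℤ) ^ (ℓ₀ / 2) * ℓ₀ | ℓ) = J(((-1 : ℤ) ^ (p / 2) * p) * ((-1 : ℤ) ^ (q / 2) * q) | ℓ)) ∧
      (δ * ((-1 : ℤ) ^ (ℓ₀ / 2) * ℓ₀)) % 4 = 1 ∧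
      ((-1 : ℤ) ^ (p / 2) * p) * (δ * ((-1 : ℤ) ^ (ℓ₀ / 2) * ℓ₀)) < 0 ∧
      (∀ ℓ : ℕ, ℓ.Prime → ℓ ∣ V.conductorNorm ℤ → ℓ ≠ 2 →
        J(((-1 : ℤ) ^ (p / 2) * p) * (δ * ((-1 : ℤ) ^ (ℓ₀ / 2) * ℓ₀)) | ℓ) = 1) ∧
      (2 ∣ V.conductorNorm ℤ → (((-1 : ℤ) ^ (p / 2) * p) * (δ * ((-1 : ℤ) ^ (ℓ₀ / 2) * ℓ₀))) % 8 = 1) ∧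
      CX • X = V.quadraticTwist ((δ * ((-1 : ℤ) ^ (ℓ₀ / 2) * ℓ₀) : ℤ) : ℚ) ∧ X.rootNumber = -1 := by
  have hp2 : p ≠ 2 := by omega
  have hpq : p ≠ q := fun h ↦ hqp h.symm
  -- notation
  set ps : ℤ := (-1 : ℤ) ^ (p / 2) * p with hps
  set qs : ℤ := (-1 : ℤ) ^ (q / 2) * q with hqs
  set dK : ℤ := NumberField.discr K with hdK
  have hdK0 : dK ≠ 0 := NumberField.discr_ne_zero K
  have hdKq : (dK : ℚ) ≠ 0 := by exact_mod_cast hdK0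
  have hdKneg : dK < 0 := hK.discr_neg
  obtain ⟨hdK8, hdK4, -, hdKsq⟩ := discr_emod_eight_of_two_split K hK h2K
  -- the bad primes
  have hpN : p ∣ W.conductorNorm ℤ :=
    (W.dvd_conductorNorm_iff_not_hasGoodReductionAtPrime p).mpr hcell.2.1.1
  have hNW0 : W.conductorNorm ℤ ≠ 0 := (W.conductorNorm_pos_holds).ne'
  -- §a the good-ordinary partner `V`
  obtain ⟨V, iV, iVm, CV, hCV, hordV, ⟨C', hC'⟩, hNWV, hpNV, hrootW⟩ :=
    exists_goodOrd_partner_rootNumber W p hmod hp5 hcell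
  have hNV0 : V.conductorNorm ℤ ≠ 0 := (V.conductorNorm_pos_holds).ne'
  have hNVW : V.conductorNorm ℤ ∣ W.conductorNorm ℤ := ⟨p ^ 2, hNWV⟩
  -- §b the genus factor `δ₁`
  obtain ⟨hfac, hδ4, hδsq, hqδ, hpδ, hδgood⟩ :=
    genusFactor_spec (p := p) (q := q) W K hK h2K hq2 hqd hsplit hpN hpq
  set δ : ℤ := dK / qs with hδ
  -- make `d_K` and `δ₁` opaque (their values are never unfolded again; this keeps `isDefEq` cheap)
  rw [← hdK] at hfac hdK8 hdK4 hdKsq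
  clear_value δ dK
  have hδ0 : δ ≠ 0 := by rintro h; rw [h, mul_zero] at hfac; exact hdK0 hfac
  have hpsδ0 : ps * δ ≠ 0 := mul_ne_zero (by
    rw [hps]; exact mul_ne_zero (pow_ne_zero _ (by norm_num)) (by exact_mod_cast hp.out.ne_zero)) hδ0
  -- §c the auxiliary prime `ℓ₀`
  set σ : ℤ := - Int.sign (ps * δ) with hσ
  have hσ1 : σ = 1 ∨ σ = -1 := by
    rcases lt_trichotomy (ps * δ) 0 with h | h | h
    · left; rw [hσ, Int.sign_eq_neg_one_of_neg h]; norm_num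
    · exact (hpsδ0 h).elim
    · right; rw [hσ, Int.sign_eq_one_of_pos h]
  set M : ℕ := W.conductorNorm ℤ * M₀ with hM
  have hM0 : M ≠ 0 := mul_ne_zero hNW0 hM₀
  set Scrt : Finset ℕ := M.primeFactors.erase 2 with hScrt
  have hScrt_mem : ∀ ℓ, ℓ ∈ Scrt ↔ ℓ.Prime ∧ ℓ ∣ M ∧ ℓ ≠ 2 := fun ℓ ↦ by
    rw [hScrt, Finset.mem_erase, Nat.mem_primeFactors]; tauto
  set η : ℕ → ℤ := fun ℓ ↦ if ℓ = p then 1 else if ℓ = q then J(ps * δ | q) else J(ps * qs | ℓ)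
    with hη
  have hpsq : ¬ (q : ℤ) ∣ ps * δ := by
    intro h
    rcases Int.Prime.dvd_mul' hq.out h with h | h
    · exact hqp (eq_of_prime_dvd_pStar (p := p) hq.out h)
    · exact hqδ h
  have hη1 : ∀ ℓ ∈ Scrt, η ℓ = 1 ∨ η ℓ = -1 := by
    intro ℓ hℓ
    obtain ⟨hℓp, -, -⟩ := (hScrt_mem ℓ).mp hℓ
    simp only [hη]
    split_ifs with h1 h2
    · exact Or.inl rfl
    · subst h2
      rcases jacobiSym.trichotomy (ps * δ) ℓ with h0 | h0 | h0
      · exfalso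
        have := jacobiSym_mul_self_eq_one hq.out hpsq
        rw [h0, mul_zero] at this
        exact zero_ne_one this
      · exact Or.inl h0
      · exact Or.inr h0
    · rcases jacobiSym.trichotomy (ps * qs) ℓ with h0 | h0 | h0
      · exfalso
        have := jacobiSym_mul_self_eq_one hℓp (not_dvd_pStar_mul_pStar (p := p) hℓp hq.out h1 h2)
        rw [h0, mul_zero] at this
        exact zero_ne_one this
      · exact Or.inl h0
      · exact Or.inr h0
  set B : ℕ := M * dK.natAbs with hB
  obtain ⟨ℓ₀, hℓ₀, hBℓ₀, hσℓ₀, h8ℓ₀, hJℓ₀⟩ := exists_prime_star_prescribed hp.out hp2 hq.out hq2 hσ1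
    Scrt (fun ℓ hℓ ↦ ⟨((hScrt_mem ℓ).mp hℓ).1, ((hScrt_mem ℓ).mp hℓ).2.2⟩) η hη1 B
  set ls : ℤ := (-1 : ℤ) ^ (ℓ₀ / 2) * ℓ₀ with hls
  -- `ℓ₀` is large: it divides neither `M = N_E N_{Wd}` nor `d_K`, and `ℓ₀ ∉ {2, p, q}`
  have hB0 : B ≠ 0 := mul_ne_zero hM0 (Int.natAbs_ne_zero.mpr hdK0)
  have hℓ₀M : ¬ ℓ₀ ∣ M := fun h ↦ by
    have := Nat.le_of_dvd (Nat.pos_of_ne_zero hM0) h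
    have : M ≤ B := Nat.le_mul_of_pos_right M (Nat.pos_of_ne_zero (Int.natAbs_ne_zero.mpr hdK0))
    omega
  have hℓ₀dK : ¬ (ℓ₀ : ℤ) ∣ dK := fun h ↦ by
    have h' : ℓ₀ ∣ dK.natAbs := by simpa using Int.natAbs_dvd_natAbs.mpr h
    have := Nat.le_of_dvd (Nat.pos_of_ne_zero (Int.natAbs_ne_zero.mpr hdK0)) h'
    have : dK.natAbs ≤ B := Nat.le_mul_of_pos_left _ (Nat.pos_of_ne_zero hM0)
    omega
  have hℓ₀NW : ¬ ℓ₀ ∣ W.conductorNorm ℤ := fun h ↦ hℓ₀M (h.mul_right _)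
  have hℓ₀M₀ : ¬ ℓ₀ ∣ M₀ := fun h ↦ hℓ₀M (h.mul_left _)
  have hℓ₀p : ℓ₀ ≠ p := fun h ↦ hℓ₀NW (h ▸ hpN)
  have hℓ₀q : ℓ₀ ≠ q := fun h ↦ hℓ₀dK (by rw [h]; exact hqd)
  have hℓ₀δ : ¬ (ℓ₀ : ℤ) ∣ δ := fun h ↦ hℓ₀dK (h.trans ⟨qs, by rw [mul_comm]; exact hfac⟩)
  have hℓ₀2 : ℓ₀ ≠ 2 := by
    rintro rfl
    have := h8ℓ₀
    omega
  have hℓ₀odd : ℓ₀ % 2 = 1 := Nat.odd_iff.mp (hℓ₀.eq_two_or_odd'.resolve_left hℓ₀2)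
  have hls4 : ls % 4 = 1 := (haveI := Fact.mk hℓ₀; pStar_emod_four (p := ℓ₀) hℓ₀2)
  have hps4 : ps % 4 = 1 := pStar_emod_four (p := p) hp2
  have hqs4 : qs % 4 = 1 := pStar_emod_four (p := q) hq2
  -- §d the auxiliary twist `T = δ₁ ℓ₀*` and `X ≅ V^{(T)}` with `w(X) = −1`
  set T : ℤ := δ * ls with hT
  have hT4 : T % 4 = 1 := by
    rw [hT, Int.mul_emod, hδ4, hls4]; decide
  have hT0 : T ≠ 0 := by rintro h; rw [h] at hT4; norm_num at hT4
  have hTq : (T : ℚ) ≠ 0 := by exact_mod_cast hT0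
  -- the sign hypotheses of `jacobiSym_rootNumber_sign`
  have hVroot : V.rootNumber = 1 ∨ V.rootNumber = -1 := V.rootNumber_eq_one_or
  have h1 : J(-1 | p) * J((V.conductorNorm ℤ : ℤ) | p) * V.rootNumber = 1 := by rw [← hrootW, hw]
  have hpsT : ps * T = (ps * δ) * ls := by rw [hT]; ring
  have hb : ∀ ℓ : ℕ, ℓ.Prime → ℓ ∣ V.conductorNorm ℤ → ℓ ≠ 2 → J(ps * T | ℓ) = 1 := by
    intro ℓ hℓ hℓN hℓ2
    have hℓW : ℓ ∣ W.conductorNorm ℤ := hℓN.trans hNVW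
    have hℓp : ℓ ≠ p := by rintro rfl; exact hpNV hℓN
    by_cases hℓq : ℓ = q
    · subst hℓq
      have hq' : J(ls | ℓ) = J(ps * δ | ℓ) := by
        have := hJℓ₀ ℓ ((hScrt_mem ℓ).mpr ⟨hℓ, hℓW.mul_right _, hℓ2⟩)
        simp only [hη, hqp, if_false, if_true] at this
        exact this
      rw [hpsT, jacobiSym.mul_left, hq']
      exact jacobiSym_mul_self_eq_one hq.out hpsq
    · have hJ' : J(ls | ℓ) = J(ps * qs | ℓ) := by
        have := hJℓ₀ ℓ ((hScrt_mem ℓ).mpr ⟨hℓ, hℓW.mul_right _, hℓ2⟩)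
        simp only [hη, hℓp, hℓq, if_false] at this
        exact this
      have hdKℓ : J(dK | ℓ) = 1 := by
        rw [hdK]
        exact (Quadratic.ncard_primesOver_eq_two_iff_jacobiSym hK.1 hℓ hℓ2).mp (hsplit ℓ hℓ hℓW hℓq)
      have hpsℓ : ¬ (ℓ : ℤ) ∣ ps := fun hd ↦ hℓp (eq_of_prime_dvd_pStar (p := p) hℓ hd)
      have e1 : J(ps * T | ℓ) = J(ps * δ | ℓ) * J(ls | ℓ) := by
        rw [hpsT]; exact jacobiSym.mul_left _ _ _
      have e2 : J(ps * δ | ℓ) = J(ps | ℓ) * J(δ | ℓ) := jacobiSym.mul_left _ _ _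
      have e3 : J(ps * qs | ℓ) = J(ps | ℓ) * J(qs | ℓ) := jacobiSym.mul_left _ _ _
      have e4 : J(qs * δ | ℓ) = J(qs | ℓ) * J(δ | ℓ) := jacobiSym.mul_left _ _ _
      have hsq := jacobiSym_mul_self_eq_one hℓ hpsℓ
      have hqδ1 : J(qs | ℓ) * J(δ | ℓ) = 1 := by rw [← e4, ← hfac, hdKℓ]
      rw [e1, hJ', e2, e3]
      calc J(ps | ℓ) * J(δ | ℓ) * (J(ps | ℓ) * J(qs | ℓ))
          = (J(ps | ℓ) * J(ps | ℓ)) * (J(qs | ℓ) * J(δ | ℓ)) := by ring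
        _ = 1 := by rw [hsq, hqδ1, one_mul]
  have h8 : 2 ∣ V.conductorNorm ℤ → (ps * T) % 8 = 1 := by
    intro _
    -- `ps T qs² = (ps qs ls)(qs δ) ≡ 1` and `qs² ≡ 1 (mod 8)`
    have e : ps * T * (qs * qs) = (ps * qs * ls) * (qs * δ) := by rw [hT]; ring
    have h1' : (ps * T * (qs * qs)) % 8 = 1 := by
      rw [e, Int.mul_emod, h8ℓ₀, ← hfac, hdK8]; decide
    have hqs2 : (qs * qs) % 8 = 1 := Int.mul_self_emod_eight_of_odd (by omega)
    have h2' : (ps * T * (qs * qs)) % 8 = ((ps * T) % 8 * ((qs * qs) % 8)) % 8 := Int.mul_emod _ _ _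
    rw [hqs2, mul_one, Int.emod_emod_of_dvd _ (dvd_refl (8 : ℤ))] at h2'
    rw [← h2', h1']
  have hneg : ps * T < 0 := by
    rw [hpsT, hls, hσℓ₀, hσ]
    have habs : (ps * δ) * Int.sign (ps * δ) = ((ps * δ).natAbs : ℤ) := Int.mul_sign_self (ps * δ)
    have hpos : (0 : ℤ) < (ps * δ).natAbs := by exact_mod_cast Int.natAbs_pos.mpr hpsδ0
    have hℓ₀pos : (0 : ℤ) < ℓ₀ := by exact_mod_cast hℓ₀.pos
    nlinarith [habs, hpos, hℓ₀pos]
  obtain ⟨X, iX, iXm, CX, hCX⟩ := exists_isGloballyMinimal_smul_eq_quadraticTwist V hTq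
  haveI := V.isElliptic_quadraticTwist hTq
  have hXroot : X.rootNumber = -1 := by
    have hgcd : Int.gcd T (V.conductorNorm ℤ) = 1 := by
      rw [Int.gcd_eq_natAbs, Int.natAbs_natCast]
      refine Nat.coprime_of_dvd fun ℓ hℓ hℓT hℓN ↦ ?_
      have hℓT' : (ℓ : ℤ) ∣ T := by
        have := Int.natAbs_dvd_natAbs.mp (by simpa using hℓT : (ℓ : ℤ).natAbs ∣ T.natAbs); exact this
      rw [hT] at hℓT'
      rcases Int.Prime.dvd_mul' hℓ hℓT' with h | h
      · exact hδgood ℓ hℓ h (hℓN.trans hNVW)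
      · have h' : ℓ ∣ ls.natAbs := by simpa using Int.natAbs_dvd_natAbs.mpr h
        rw [hls, natAbs_pStar] at h'
        rw [(Nat.prime_dvd_prime_iff_eq hℓ hℓ₀).mp h'] at hℓN
        exact hℓ₀NW (hℓN.trans hNVW)
    have hTsq : Squarefree T := by
      rw [hT, squarefree_mul_iff]
      refine ⟨?_, hδsq, ?_⟩
      · refine (Int.isCoprime_iff_gcd_eq_one.mpr ?_).isRelPrime
        rw [Int.gcd_eq_natAbs, hls, natAbs_pStar]
        exact Nat.Coprime.symm ((Nat.Prime.coprime_iff_not_dvd hℓ₀).mpr fun h ↦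
          hℓ₀δ (Int.natAbs_dvd_natAbs.mp (by simpa using h)))
      · rw [hls]; exact (haveI := Fact.mk hℓ₀; squarefree_pStar (p := ℓ₀))
    obtain ⟨hrootX, -⟩ := V.rootNumber_quadraticTwist_of_emod_four_eq_one hmod hT4 hTsq hgcd
    rw [← hCX, X.rootNumber_smul_holds CX] at hrootX
    -- wait: `(CX • X).rootNumber = X.rootNumber`; we need `X.rootNumber = (V.qT T).rootNumber`
    rw [hrootX]
    exact jacobiSym_rootNumber_sign hp.out hp2 hT4 hNV0 hVroot h1 hb h8 hneg
  refine ⟨V, iV, iVm, C', δ, ℓ₀, X, iX, iXm, CX, hC', hordV, hNWV, hfac, hδsq, hpδ, hδ0, hℓ₀, hℓ₀p, hℓ₀q,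
    hℓ₀M, hℓ₀δ, h8ℓ₀, fun ℓ hℓ hℓM hℓ2 hℓp hℓq ↦ ?_, hT4, hneg, hb, h8, hCX, hXroot⟩
  have := hJℓ₀ ℓ ((hScrt_mem ℓ).mpr ⟨hℓ, hℓM, hℓ2⟩)
  simp only [hη, hℓp, hℓq, if_false] at this
  exact this

end Class

end Summit.BirchSwinnertonDyer.BirchSwinnertonDyer.Theorems.ThreeFieldRoadSupply

end
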